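import Literature.AlgebraicGeometry.Resolution.AlterationsDescent
import Literature.AlgebraicGeometry.Resolution.StrictNormalCrossingsFlatDescent
import Literature.AlgebraicGeometry.Resolution.RegularLocalRingsFlatDescent
import Literature.AlgebraicGeometry.Motives.ProjectiveDescentProperProofs
import Mathlib.AlgebraicGeometry.ZariskisMainTheorem
import Mathlib.AlgebraicGeometry.Morphisms.SchemeTheoreticallyDominant
import HarnessLib

/-!
# De Jong 1996, 4.5: descent of a solution of Theorem 4.1 at one finite stage

Topic: `Literature/AlgebraicGeometry/Resolution`. Support file for the discharge of the limit
argument `DeJong1996.FiniteSubextension45` (de Jong 1996, 4.5: "there exists a finite extension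
`k₁` of `k` contained in `k̄` such that `X̄', X̄₁, X̄̄₁, φ̄₁` and `j̄₁` exist over `k₁`"). The limit
formalism (`Literature/AlgebraicGeometry/Limits/*`) produces, at a finite stage `k₁ = k(t)`,
schemes `E ⊇ U`, `X'` over `k₁` and a morphism `φ : U → X'` whose base changes along
`Spec k̄ → Spec k₁` are the data `X̄̄₁ ⊇ X̄₁`, `X̄'`, `φ̄₁` over `k̄`. This file proves, by faithfully
flat descent along the (affine, flat, surjective) base change of `Spec k̄ → Spec k₁`, that the
properties required by Thm. 4.1 pass from the data over `k̄` to the data over `k₁`: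

* `DeJong1996.Stage.isIntegral_of_isPullback` — `E` is integral (`X̄̄₁` is);
* `….isRegular_of_isPullback` — `E` is regular (Matsumura 23.7,
  `IsRegularLocalRing.of_flat_of_isLocalHom`);
* `….isPullback_restrict` — the square `(X̄₁ → U, φ̄₁, φ, X̄' → X')` is cartesian;
* `….isProper_of_isPullback`, `….isDominant_of_isPullback`, `….exists_isFinite_restrict`
  (Stacks 02UP, Mathlib `exists_isFinite_morphismRestrict_of_finite_preimage_singleton`),
  `….isAlteration_of_isPullback` — `φ` is an alteration (`φ̄₁` is);
* `….etale_of_isPullback` — `φ` is étale on an open whose preimage `φ̄₁` is étale on;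

(the strict normal crossings boundary is `IsStrictNormalCrossingsDivisor.of_preimage` of
`StrictNormalCrossingsFlatDescent.lean`; projectivity is handled with the explicit embedding).

## References

* A. J. de Jong, *Smoothness, semi-stability and alterations*, Publ. Math. IHÉS 83 (1996), 4.5.
* U. Görtz, T. Wedhorn, *Algebraic Geometry I* (2020), §14.11–14.13 (faithfully flat descent).
* The Stacks Project, Tag 02UP.
-/

noncomputable section

universe u

open CategoryTheory CategoryTheory.Limits AlgebraicGeometry TopologicalSpace MorphismProperty

namespace Literature.AlgebraicGeometry.Resolution

namespace DeJong1996.Stage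

set_option backward.isDefEq.respectTransparency false

/-! ## The base change morphism `Spec K → Spec F` -/

section Base

variable {F K : Type u} [Field F] [Field K] (σ : F →+* K)

/-- `Spec K → Spec F` is surjective, flat and quasi-compact (an fpqc cover). [folklore] -/
theorem fpqc_specMap :
    (@Surjective ⊓ @Flat ⊓ @QuasiCompact : MorphismProperty Scheme.{u})
      (Spec.map (CommRingCat.ofHom σ)) := by
  letI := σ.toAlgebra
  exact Literature.AlgebraicGeometry.Motives.ProperDescent.fpqc_specMap F K

/-- `Spec K → Spec F` is surjective. [folklore] -/
theorem surjective_specMap : Surjective (Spec.map (CommRingCat.ofHom σ)) := (fpqc_specMap σ).1.1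

/-- `Spec K → Spec F` is flat. [folklore] -/
theorem flat_specMap : Flat (Spec.map (CommRingCat.ofHom σ)) := (fpqc_specMap σ).1.2

/-- `Spec K → Spec F` is scheme-theoretically dominant (dominant onto a reduced scheme). [folklore] -/
theorem isSchemeTheoreticallyDominant_specMap :
    IsSchemeTheoreticallyDominant (Spec.map (CommRingCat.ofHom σ)) :=
  haveI := surjective_specMap σ
  IsSchemeTheoreticallyDominant.of_isDominant _

end Base

/-! ## Injectivity and faithful flatness of stalk maps of a flat morphism -/

section StalkMaps

variable {X Y : Scheme.{u}} (π : X ⟶ Y) [Flat π]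

/-- The stalk maps of a flat morphism are faithfully flat local homomorphisms, hence injective.
[folklore] -/
theorem stalkMap_injective_of_flat (x : X) : Function.Injective (π.stalkMap x).hom := by
  letI := (π.stalkMap x).hom.toAlgebra
  haveI : Module.Flat (Y.presheaf.stalk (π x)) (X.presheaf.stalk x) := Flat.stalkMap π x
  haveI : IsLocalHom (algebraMap (Y.presheaf.stalk (π x)) (X.presheaf.stalk x)) :=
    inferInstanceAs (IsLocalHom (π.stalkMap x).hom)
  haveI : Module.FaithfullyFlat (Y.presheaf.stalk (π x)) (X.presheaf.stalk x) :=
    Module.FaithfullyFlat.of_flat_of_isLocalHom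
  rw [RingHom.injective_iff_ker_eq_bot, RingHom.ker_eq_comap_bot]
  have h := Ideal.comap_map_eq_self_of_faithfullyFlat (B := X.presheaf.stalk x)
    (⊥ : Ideal (Y.presheaf.stalk (π x)))
  rw [Ideal.map_bot] at h
  exact h

/-- **Reducedness descends along a flat surjective morphism.** [folklore] -/
theorem isReduced_of_flat_surjective [Surjective π] [IsReduced X] : IsReduced Y := by
  haveI : ∀ y : Y, _root_.IsReduced (Y.presheaf.stalk y) := fun y => by
    obtain ⟨x, rfl⟩ := π.surjective y
    exact isReduced_of_injective _ (stalkMap_injective_of_flat π x)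
  exact isReduced_of_isReduced_stalk Y

/-- **Integrality descends along a flat surjective morphism** from an integral scheme. [folklore] -/
theorem isIntegral_of_flat_surjective [Surjective π] [IsIntegral X] : IsIntegral Y := by
  haveI : IsReduced Y := isReduced_of_flat_surjective π
  haveI : IrreducibleSpace Y := by
    rw [irreducibleSpace_def]
    have h : IsIrreducible (Set.range π) := by
      rw [← Set.image_univ]
      exact (IrreducibleSpace.isIrreducible_univ X).image _ π.continuous.continuousOn
    rwa [π.surjective.range_eq] at h
  exact isIntegral_of_irreducibleSpace_of_isReduced Y

/-- **Regularity descends along a flat surjective morphism** to a locally Noetherian scheme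
(Matsumura, Thm. 23.7 (i), stalkwise). [cite: Matsumura1987, Thm. 23.7 (i)] -/
theorem isRegular_of_flat_surjective [Surjective π] [IsLocallyNoetherian Y]
    (hX : Scheme.IsRegular X) : Scheme.IsRegular Y := by
  intro y
  obtain ⟨x, rfl⟩ := π.surjective y
  letI := (π.stalkMap x).hom.toAlgebra
  haveI : Module.Flat (Y.presheaf.stalk (π x)) (X.presheaf.stalk x) := Flat.stalkMap π x
  haveI : IsLocalHom (algebraMap (Y.presheaf.stalk (π x)) (X.presheaf.stalk x)) :=
    inferInstanceAs (IsLocalHom (π.stalkMap x).hom)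
  haveI : IsRegularLocalRing (X.presheaf.stalk x) := hX x
  exact IsRegularLocalRing.of_flat_of_isLocalHom (Y.presheaf.stalk (π x)) (X.presheaf.stalk x)

end StalkMaps

/-! ## The cartesian square at a stage and descent of properties of `φ` -/

section Square

variable {F K : Type u} [Field F] [Field K] (σ : F →+* K)
variable {E Xbar₁ X' Xb : Scheme.{u}} {qE : E ⟶ Spec (.of F)} {legE : Xbar₁ ⟶ E}
  {gK : Xbar₁ ⟶ Spec (.of K)}
  (hE : IsPullback legE gK qE (Spec.map (CommRingCat.ofHom σ)))
  {qX : X' ⟶ Spec (.of F)} {legX : Xb ⟶ X'} {gKb : Xb ⟶ Spec (.of K)}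
  (hX : IsPullback legX gKb qX (Spec.map (CommRingCat.ofHom σ)))

include hX in
/-- The base change `X̄' → X'` of `Spec K → Spec F` is surjective, flat and quasi-compact.
[folklore] -/
theorem fpqc_leg :
    (@Surjective ⊓ @Flat ⊓ @QuasiCompact : MorphismProperty Scheme.{u}) legX :=
  MorphismProperty.of_isPullback (P := (@Surjective ⊓ @Flat ⊓ @QuasiCompact :
    MorphismProperty Scheme.{u})) hX.flip (fpqc_specMap σ)

include hX in
/-- The base change `X̄' → X'` of `Spec K → Spec F` is surjective. [folklore] -/
theorem surjective_leg : Surjective legX := (fpqc_leg σ hX).1.1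

include hX in
/-- The base change `X̄' → X'` of `Spec K → Spec F` is flat. [folklore] -/
theorem flat_leg : Flat legX := (fpqc_leg σ hX).1.2

include hX in
/-- The base change `X̄' → X'` of `Spec K → Spec F` is affine. [folklore] -/
theorem isAffineHom_leg : IsAffineHom legX :=
  MorphismProperty.of_isPullback (P := @IsAffineHom) hX.flip inferInstance

variable (U : E.Opens) {φ : (U : Scheme.{u}) ⟶ X'} (hφ : φ ≫ qX = U.ι ≫ qE)
  {φ₁ : (legE ⁻¹ᵁ U : Scheme.{u}) ⟶ Xb} (hφ₁ : φ₁ ≫ gKb = (legE ⁻¹ᵁ U).ι ≫ gK)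
  (hcomm : φ₁ ≫ legX = (legE ∣_ U) ≫ φ)

include hE in
/-- The restriction `X̄₁ = legE⁻¹ U → U` of the base change square to an open of `E` is again
a base change of `Spec K → Spec F`. [folklore] -/
theorem isPullback_restrict_base :
    IsPullback (legE ∣_ U) ((legE ⁻¹ᵁ U).ι ≫ gK) (U.ι ≫ qE)
      (Spec.map (CommRingCat.ofHom σ)) :=
  (isPullback_morphismRestrict legE U).paste_vert hE

include hE hX hφ hφ₁ hcomm in
/-- **The square `(X̄₁ → U, φ̄₁ : X̄₁ → X̄', φ : U → X', X̄' → X')` is cartesian**: both vertical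
maps are base changes of `Spec K → Spec F` and the square lives over it. [folklore] -/
theorem isPullback_restrict : IsPullback φ₁ (legE ∣_ U) legX φ := by
  refine IsPullback.of_right ?_ hcomm hX.flip
  rw [hφ₁, hφ]
  exact (isPullback_restrict_base σ hE U).flip

include hE hX hφ hφ₁ hcomm in
/-- **Properness of `φ` descends from that of `φ̄₁`** (fpqc descent of universally closed,
locally of finite type — Mathlib — and separated, Görtz–Wedhorn I Prop. 14.51/14.53).
[cite: GortzWedhorn2020, Prop. 14.53 (5) (p. 569)] -/
theorem isProper_of_isPullback [IsProper φ₁] : IsProper φ := by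
  have sq := isPullback_restrict σ hE hX U hφ hφ₁ hcomm
  have hq := fpqc_leg σ hX
  have h1 : UniversallyClosed φ :=
    of_isPullback_of_descendsAlong (P := @UniversallyClosed)
      (Q := (@Surjective ⊓ @Flat ⊓ @QuasiCompact : MorphismProperty Scheme.{u})) sq hq
      inferInstance
  have h2 : LocallyOfFiniteType φ :=
    of_isPullback_of_descendsAlong (P := @LocallyOfFiniteType)
      (Q := (@Surjective ⊓ @Flat ⊓ @QuasiCompact : MorphismProperty Scheme.{u})) sq hq
      inferInstance
  have h3 : IsSeparated (pullback.fst legX φ) := by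
    rw [← sq.isoPullback_inv_fst]
    infer_instance
  have h4 : IsSeparated φ :=
    Literature.AlgebraicGeometry.Motives.ProperDescent.isSeparated_of_isSeparated_pullback_fst
      φ legX hq
  exact ⟨⟩

include hX hcomm in
/-- **Dominance of `φ` from that of `φ̄₁`**: `X̄' → X'` is surjective and the square commutes.
[folklore] -/
theorem isDominant_of_comm [IsDominant φ₁] : IsDominant φ := by
  haveI := surjective_leg σ hX
  refine ⟨dense_iff_closure_eq.mpr (Set.eq_univ_of_univ_subset ?_)⟩
  have h1 : Set.range legX ⊆ closure (Set.range (φ₁ ≫ legX)) := by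
    rintro _ ⟨x, rfl⟩
    have hx : x ∈ closure (Set.range φ₁) := φ₁.denseRange.closure_range ▸ Set.mem_univ x
    have := Set.mem_of_mem_of_subset (Set.mem_image_of_mem legX hx)
      (image_closure_subset_closure_image legX.continuous)
    have e : ⇑(φ₁ ≫ legX) = legX ∘ φ₁ := funext fun y => Scheme.Hom.comp_apply _ _ y
    rwa [← Set.range_comp, ← e] at this
  rw [legX.surjective.range_eq] at h1
  refine h1.trans (closure_mono ?_)
  rw [hcomm]
  rintro _ ⟨x, rfl⟩
  exact ⟨(legE ∣_ U) x, (Scheme.Hom.comp_apply _ _ x).symm⟩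

include hE hX hφ hφ₁ hcomm in
/-- **Generic finiteness of `φ` from that of `φ̄₁`** (for `φ̄₁` an alteration): the fibre of `φ`
over the generic point `η'` of `X'` is contained in the image of the fibre of `φ̄₁` over the
generic point of `X̄'` — a single point (`eq_genericPoint_of_isFinite_restrict`) — so `φ`, being
proper, is finite over a neighbourhood of `η'` (Stacks 02UP, Mathlib
`exists_isFinite_morphismRestrict_of_finite_preimage_singleton`). [cite: StacksProject, Tag 02UP] -/
theorem exists_isFinite_restrict [IsIntegral X'] [IsIntegral Xb] [IsProper φ₁]
    (hφ₁a : IsAlteration φ₁) : ∃ V : X'.Opens, (V : Set X').Nonempty ∧ IsFinite (φ ∣_ V) := by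
  haveI := hφ₁a.isIntegral
  haveI := hφ₁a.isDominant
  haveI : IsProper φ := isProper_of_isPullback σ hE hX U hφ hφ₁ hcomm
  haveI := surjective_leg σ hX
  haveI := flat_leg σ hX
  have sq := isPullback_restrict σ hE hX U hφ hφ₁ hcomm
  -- the generic point of `X̄'` maps to that of `X'`
  haveI : IsDominant legX := ⟨legX.surjective.denseRange⟩
  have hη : legX (genericPoint Xb) = genericPoint X' := genericPoint_eq_of_isDominant legX
  -- the fibre of `φ` over `η'` lies in the image of the fibre of `φ̄₁` over `η̄`
  obtain ⟨W, hWne, hWfin⟩ := hφ₁a.exists_isFinite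
  haveI := hWfin
  have hfib : φ ⁻¹' {genericPoint X'} ⊆ (legE ∣_ U) '' (φ₁ ⁻¹' {genericPoint Xb}) := by
    intro u hu
    obtain ⟨z, hz1, hz2⟩ := Scheme.Pullback.exists_preimage_pullback (genericPoint Xb) u
      (show legX (genericPoint Xb) = φ u by rw [hη]; exact hu.symm)
    refine ⟨sq.isoPullback.inv z, ?_, ?_⟩
    · change φ₁ (sq.isoPullback.inv z) = genericPoint Xb
      rw [← Scheme.Hom.comp_apply, sq.isoPullback_inv_fst]
      exact hz1
    · rw [← Scheme.Hom.comp_apply, sq.isoPullback_inv_snd]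
      exact hz2
  have hfin1 : (φ₁ ⁻¹' {genericPoint Xb}).Finite := by
    have hηW : genericPoint Xb ∈ W :=
      ((genericPoint_spec Xb).mem_open_set_iff W.isOpen).mpr (by simpa using hWne)
    refine Set.Finite.subset (Set.finite_singleton (genericPoint _)) fun x hx => ?_
    exact eq_genericPoint_of_isFinite_restrict φ₁ W (by simpa [Set.mem_preimage] using hx ▸ hηW) hx
  have hfin : (φ ⁻¹' {genericPoint X'}).Finite := (hfin1.image _).subset hfib
  obtain ⟨V, hηV, hV⟩ :=
    exists_isFinite_morphismRestrict_of_finite_preimage_singleton φ (genericPoint X') hfin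
  exact ⟨V, ⟨_, hηV⟩, hV⟩

include hE hX hφ hφ₁ hcomm in
/-- **`φ` is an alteration if `φ̄₁` is** (with `U` integral). [cite: DeJong1996, 4.5, p. 66] -/
theorem isAlteration_of_isPullback [IsIntegral X'] [IsIntegral Xb] [IsIntegral U]
    (hφ₁a : IsAlteration φ₁) : IsAlteration φ := by
  haveI := hφ₁a.isIntegral
  haveI := hφ₁a.isDominant
  haveI := hφ₁a.isProper
  exact
    { isIntegral := ‹_›
      isProper := isProper_of_isPullback σ hE hX U hφ hφ₁ hcomm
      isDominant := isDominant_of_comm σ hX U hcomm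
      exists_isFinite := exists_isFinite_restrict σ hE hX U hφ hφ₁ hcomm hφ₁a }

include hE hX hφ hφ₁ hcomm in
/-- **Étaleness of `φ` on an open `W ⊆ U` descends from étaleness of `φ̄₁` on its preimage**
(fpqc descent of étale morphisms, Mathlib). [folklore] -/
theorem etale_restrict_of_isPullback (W : E.Opens) (hWU : W ≤ U)
    [Etale (Xbar₁.homOfLE (legE.preimage_mono hWU) ≫ φ₁)] :
    Etale (E.homOfLE hWU ≫ φ) := by
  have sq := isPullback_restrict σ hE hX U hφ hφ₁ hcomm
  have hq := fpqc_leg σ hX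
  -- the square restricted to `W`
  have sqW : IsPullback (Xbar₁.homOfLE (legE.preimage_mono hWU) ≫ φ₁) (legE ∣_ W) legX
      (E.homOfLE hWU ≫ φ) := by
    have h1 : IsPullback (Xbar₁.homOfLE (legE.preimage_mono hWU)) (legE ∣_ W) (legE ∣_ U)
        (E.homOfLE hWU) := by
      refine IsPullback.of_right (h₁₂ := (legE ⁻¹ᵁ U).ι) (h₂₂ := U.ι) ?_
        (morphismRestrict_homOfLE legE W U hWU).symm (isPullback_morphismRestrict legE U).flip
      simpa only [Scheme.homOfLE_ι] using (isPullback_morphismRestrict legE W).flip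
    exact h1.paste_horiz sq
  exact of_isPullback_of_descendsAlong (P := @Etale)
    (Q := (@Surjective ⊓ @Flat ⊓ @QuasiCompact : MorphismProperty Scheme.{u})) sqW hq
    inferInstance

end Square


end DeJong1996.Stage

end Literature.AlgebraicGeometry.Resolution

end
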